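/-
Origin: HOME/pub-hodgecm-prl1/lean/Prl1/CorCMThetaPrime.lean — session planner-pub-hodgecm-prl1-0 (unit pub-hodgecm-prl1).
Intended final place: `HodgeCM/Assembly/CorCMThetaPrime.lean` (imports `HodgeCM.Assembly.CorCMTheta` and
`HodgeCM.Proofs.LevelDirected`): the headline theorems of `CorCMTheta` / `RealisationConstruction` with the hypothesis
`hLD : HodgeCM.LevelDirected` DISCHARGED by `HodgeCM.levelDirected`.  (Split form of handover v2's `Prl1/LevelDirected.lean`.)
Origin: expansion seat `planner-pub-hodgecm-prl1-0` (unit pub-hodgecm-prl1), handover v2 2026-08-18T03:16:26Z in the split form offered 03:23:21Z (`HOME/pub-hodgecm-prl1/lean/Prl1/CorCMThetaPrime.lean`, md5 bc203026);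
landed by the gen-5 packager as `HodgeCM/Assembly/CorCMThetaPrime.lean` (module `Prl1.CorCMThetaPrime` → `HodgeCM.Assembly.CorCMThetaPrime`; `import Prl1.*` lines renamed to the package modules; module references in prose renamed on 3 line(s); body otherwise verbatim).
-/
import Summits.HodgeConjecture.HodgeCM.Assembly.CorCMTheta
import Summits.HodgeConjecture.HodgeCM.Proofs.LevelDirected

set_option autoImplicit false

/-!
# The realisation inputs and `COR_CM` from the theta model, without the directedness hypothesis

`HodgeCM.levelDirected : HodgeCM.LevelDirected` (proved in `HodgeCM.Proofs.LevelDirected`) is substituted for the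
hypothesis `hLD` of `ThetaModel.realisationExistsPerL_of / realisationExistsFace_of` and of
`Assembly.COR_CM_theta / perL_theta / openInputs_of_theta / COR_CM_of_openInputsTheta`.  Remaining hypotheses of the
headline `COR_CM_theta'`: `U.ModelAxioms`, `T.Inputs` (ten named inputs — 2 print facts, 2 design constraints, 6 PerL open inputs — `HodgeCM.Automorphic.ThetaFacts`), `U.Fact_hodgeRiemann20`,
`HodgeCM.Lemma33bLandherr`, `U.PohlmannSpan`, `U.Qw8Sufficiency`.
-/

noncomputable section

namespace HodgeCM

namespace Universe.ThetaModel

variable {U : Universe} (T : U.ThetaModel)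

/-- `RealisationExistsPerL` from the theta model, `LevelDirected` discharged. -/
theorem realisationExistsPerL_of' (M : U.ModelAxioms) (A : T.Inputs) (hHR : U.Fact_hodgeRiemann20)
    (hL : Lemma33bLandherr) : U.RealisationExistsPerL :=
  T.realisationExistsPerL_of M A hHR levelDirected hL

/-- `RealisationExistsFace` from the theta model, `LevelDirected` discharged. -/
theorem realisationExistsFace_of' (M : U.ModelAxioms) (A : T.Inputs) (hHR : U.Fact_hodgeRiemann20)
    (hL : Lemma33bLandherr) : U.RealisationExistsFace :=
  T.realisationExistsFace_of M A hHR levelDirected hL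

end Universe.ThetaModel

namespace Assembly

variable (U : Universe)

/-- **COR-CM from the theta model**, `LevelDirected` discharged: open inputs = `T.Inputs`, `Fact_hodgeRiemann20`,
`Lemma33bLandherr`, `PohlmannSpan`, `Qw8Sufficiency`. -/
theorem COR_CM_theta' (M : U.ModelAxioms) (T : U.ThetaModel) (A : T.Inputs) (hHR : U.Fact_hodgeRiemann20)
    (hL : Lemma33bLandherr) (hP : U.PohlmannSpan) (hQ : U.Qw8Sufficiency) : U.HC_CM :=
  COR_CM_theta U M T A hHR levelDirected hL hP hQ

/-- **PerL from the theta model**, `LevelDirected` discharged. -/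
theorem perL_theta' (M : U.ModelAxioms) (T : U.ThetaModel) (A : T.Inputs) (hHR : U.Fact_hodgeRiemann20)
    (hL : Lemma33bLandherr) : U.PerL :=
  perL_theta U M T A hHR levelDirected hL

/-- The reduced record without the `levelDirected` field. -/
structure OpenInputsTheta' (T : U.ThetaModel) : Prop where
  /-- the ten automorphic facts of `HodgeCM.Automorphic.ThetaFacts` -/
  theta : T.Inputs
  /-- Hodge–Riemann for holomorphic 2-forms on a surface (PRINT) -/
  hodgeRiemann20 : U.Fact_hodgeRiemann20
  /-- Landherr's classification of hermitian planes over a CM field -/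
  landherr : Lemma33bLandherr
  /-- Pohlmann 1968 (unchanged) -/
  pohlmann_span : U.PohlmannSpan
  /-- [QW8] Thm 2.5 + Milne 1999 (unchanged) -/
  qw8_sufficiency : U.Qw8Sufficiency

/-- `U.OpenInputs` from the reduced record. -/
theorem openInputs_of_theta' (M : U.ModelAxioms) (T : U.ThetaModel) (I : OpenInputsTheta' U T) :
    U.OpenInputs :=
  openInputs_of_theta U M T ⟨I.theta, I.hodgeRiemann20, levelDirected, I.landherr, I.pohlmann_span,
    I.qw8_sufficiency⟩

/-- **COR-CM from the reduced record.** -/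
theorem COR_CM_of_openInputsTheta' (M : U.ModelAxioms) (T : U.ThetaModel) (I : OpenInputsTheta' U T) :
    U.HC_CM :=
  COR_CM_of_openInputs U M (openInputs_of_theta' U M T I)

end Assembly

end HodgeCM

end
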